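import Mathlib
import Summits.Ventures.PercRepro2.HCov
import Summits.Ventures.PercRepro2.RootLeafUTheorem
import Summits.Ventures.PercRepro2.GcParallel
import Summits.Ventures.PercRepro2.RootLeafUCoinSeries

/-!
# The parallel rule for the second coefficient `T2` (blind cell PercRepro2, p4 g15; no definitions)

Two parallel edges `g₁, g₂` (`ends g₂ = ends g₁`) are one edge of weight `p_{g₁} + p_{g₂} − p_{g₁}p_{g₂}`:
**`T2_parallel`** — `T2 p ends = T2 p′ (ends[g₂ ↦ loop at v])` with `p′ = p[g₁ ↦ p_{g₁} + p_{g₂} − p_{g₁}p_{g₂}][g₂ ↦ 0]`,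
for any loop vertex `v`, through `T2_transport_marks` (RootLeafUCoinSeries) and the parallel map of
GcParallel (`prob_parallel_pushforward`, `openGraph_parallel`).  With `T2_series` this makes the second
coefficient of the root-leaf cubic invariant under the series–parallel reductions of (HCOV), so every
class theorem for `0 ≤ T2` (the coin class of RootLeafUCoinThm in particular) extends to the graphs that
reduce to it.
-/

namespace Summit.Ventures.PercRepro2

open UnionCluster CovForm Contract RECM

namespace RootLeafU

namespace Coin

section Parallel

variable {V : Type*} {E : Type*} [Fintype E] [DecidableEq E] [DecidableEq V] {R : Type*}
  [Field R] [LinearOrder R]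

omit [DecidableEq V] [LinearOrder R] in
/-- **The parallel rule for `T2`**: two parallel edges `g₁, g₂` are one edge `g₁` of weight
`p_{g₁} + p_{g₂} − p_{g₁}p_{g₂}` with `g₂` re-routed to a loop at `v`. -/
theorem T2_parallel (p : E → R) {ends : E → Sym2 V} {g₁ g₂ : E} (h12 : g₁ ≠ g₂)
    (hpar : ends g₂ = ends g₁) (v : V) (o a₂ c b u : V) :
    T2 p ends o a₂ c b u =
      T2 (Function.update (Function.update p g₁ (p g₁ + p g₂ - p g₁ * p g₂)) g₂ 0)
        (Function.update ends g₂ s(v, v)) o a₂ c b u :=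
  (T2_transport_marks (φ := id) (prob_parallel_pushforward p h12) o a₂ c b u
    (fun ω x _ z _ => by unfold Conn; rw [openGraph_parallel h12 hpar v ω]; exact Iff.rfl)).symm

end Parallel

end Coin

end RootLeafU

end Summit.Ventures.PercRepro2
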